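import Mathlib.NumberTheory.Padics.PadicIntegers
import Mathlib.LinearAlgebra.Dimension.Localization
import Mathlib.LinearAlgebra.Dimension.Finite
import Mathlib.LinearAlgebra.FiniteDimensional.Lemmas
import Mathlib.GroupTheory.Index
import Mathlib.RingTheory.Finiteness.Basic
import HarnessLib

/-!
# The dual lattice `Hom(A, ℤ_p)` of an abelian group containing `ℤ_p^n` with finite index:
# a `ℤ_p`-linear injection `Hom(A, ℤ_p) ↪ ℤ_p^n` with `p`-saturated image is ONTO (rank count)

Topic `Algebra/Module`; namespace `Literature.Algebra.Module`; THEOREMS ONLY (no definition, no named fact, no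
instance). Mathlib-only imports.

Let `p` be a prime, `A` an abelian group and `H ≤ A` a subgroup of finite index with `H ≃ ℤ_p^τ` additively
(`τ` a finite index set). The `ℤ_p`-module `M = Hom_ℤ(A, ℤ_p)` of additive maps then contains the `#τ` linearly
independent functionals `ζ_t(a) = (t`-th coordinate of `[A : H]·a ∈ H ≃ ℤ_p^τ)`, so `rank M ≥ #τ`. Hence a
`ℤ_p`-LINEAR INJECTION `Φ : M ↪ ℤ_p^σ` with `#σ ≤ #τ` has image `V` of rank `#σ = rank ℤ_p^σ`; if moreover `V` is
`p`-SATURATED (`p·w ∈ V ⇒ w ∈ V`), the quotient `ℤ_p^σ / V` is torsion-free of rank `0` (rank–nullity over the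
domain `ℤ_p`), hence `0`: **`Φ` is surjective** (`surjective_of_injective_of_saturated`). Elementary commutative
algebra over the PID `ℤ_p` [folklore]; recorded because it is the rank count behind F. Sprung, J. Number Theory
132 (2012), Thm. 2.2 / Lemma 2.3 / Cor. 2.10 in the tree's functional model of `H¹_Iw` (the dual-form generation
clauses of `Sprung2012.IsHondaSystem` give «injective with `p`-saturated image», Silverman AEC VII.6.3 gives
`E(k_n) ⊇ ℤ_p^{[k_n:ℚ_p]}` of finite index; together: the orbit-evaluation map on functionals is ONTO the
coordinate lattice). [cite: Sprung2012, Lemma 2.3 and Cor. 2.10 (pp. 1487–1489)]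

USE (cell `bsd-ssimc`, width seat `cruxlead-stmt-BirchSwinnertonDyer-19875-w3` g7): the discharge of the
point-independence clause (IND) of `Sprung2012/ColemanMapJointCokernelProofs.lean` from the named fact
`silvermanVII63_localLayerPoints_finiteIndex_zpLattice` (`Sprung2012/HondaLevelTwoDualCoordinatesProofs.lean`).
Nothing specific to elliptic curves is used here; BSD is not proved by any of this.

## References
* [Sprung2012] F. E. I. Sprung, J. Number Theory 132 (2012) 1483–1506, Thm. 2.2, Lemma 2.3, Cor. 2.10.
* [SilvermanAEC2009] J. H. Silverman, *The Arithmetic of Elliptic Curves*, 2nd ed., VII Prop. 6.3.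
-/

noncomputable section

open scoped Classical

namespace Literature.Algebra.Module

variable {p : ℕ} [hp : Fact p.Prime]

/-! ## §1 `p`-saturated submodules of `ℤ_p`-modules -/

/-- A `p`-saturated submodule (`p·w ∈ V ⇒ w ∈ V`) is `p^k`-saturated. [folklore] -/
private theorem mem_of_pow_smul_mem_of_saturated {M : Type*} [AddCommGroup M] [Module ℤ_[p] M]
    (V : Submodule ℤ_[p] M) (hsat : ∀ w : M, (p : ℤ_[p]) • w ∈ V → w ∈ V) {k : ℕ} {w : M}
    (h : (p : ℤ_[p]) ^ k • w ∈ V) : w ∈ V := by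
  induction k generalizing w with
  | zero => rwa [pow_zero, one_smul] at h
  | succ k ih =>
    rw [pow_succ', mul_smul] at h
    exact ih (hsat _ h)

/-- A `p`-saturated submodule of a `ℤ_p`-module is saturated with respect to every non-zero scalar
(`c = u·p^{v(c)}` with `u` a unit): `c·w ∈ V`, `c ≠ 0` ⇒ `w ∈ V`. [folklore] -/
private theorem mem_of_smul_mem_of_saturated {M : Type*} [AddCommGroup M] [Module ℤ_[p] M]
    (V : Submodule ℤ_[p] M) (hsat : ∀ w : M, (p : ℤ_[p]) • w ∈ V → w ∈ V) {c : ℤ_[p]} (hc : c ≠ 0)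
    {w : M} (h : c • w ∈ V) : w ∈ V := by
  have hspec := PadicInt.unitCoeff_spec hc
  have h1 : c • w = ((PadicInt.unitCoeff hc : ℤ_[p]ˣ) : ℤ_[p]) • ((p : ℤ_[p]) ^ c.valuation • w) := by
    rw [smul_smul, ← hspec]
  have h' : (p : ℤ_[p]) ^ c.valuation • w ∈ V := by
    have h2 := V.smul_mem (((PadicInt.unitCoeff hc)⁻¹ : ℤ_[p]ˣ) : ℤ_[p]) (h1 ▸ h)
    rwa [smul_smul, Units.inv_mul, one_smul] at h2
  exact mem_of_pow_smul_mem_of_saturated V hsat h'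

/-! ## §2 The rank count -/

/-- **The functionals `ζ_t(a) = ([A:H]·a)_t` are `ℤ_p`-linearly independent in `Hom(A, ℤ_p)`**: for `H ≤ A` of
finite index with `e : H ≃ ℤ_p^τ`, evaluating a vanishing combination `∑ c_t ζ_t` at `e⁻¹(δ_s)` gives
`[A:H]·c_s = 0`. [folklore] -/
private theorem linearIndependent_dualLattice {A : Type*} [AddCommGroup A] {τ : Type*} [Fintype τ]
    (H : AddSubgroup A) [H.FiniteIndex] (e : H ≃+ (τ → ℤ_[p])) :
    LinearIndependent ℤ_[p] (fun t : τ ↦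
      (Pi.evalAddMonoidHom (fun _ : τ ↦ ℤ_[p]) t).comp (e.toAddMonoidHom.comp
        ({ toFun := fun a ↦ ⟨H.index • a, H.nsmul_index_mem a⟩,
           map_zero' := Subtype.ext (by simp),
           map_add' := fun a b ↦ Subtype.ext (by simp) } : A →+ H))) := by
  have hidx : (H.index : ℤ_[p]) ≠ 0 := by exact_mod_cast AddSubgroup.FiniteIndex.index_ne_zero
  rw [Fintype.linearIndependent_iff]
  intro c hc s
  -- evaluate the vanishing combination at `e⁻¹(δ_s)`
  set h : H := e.symm (Pi.single s 1) with hh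
  have hev := DFunLike.congr_fun hc (h : A)
  rw [AddMonoidHom.finsetSum_apply, AddMonoidHom.zero_apply] at hev
  have hval : ∀ t : τ, ((Pi.evalAddMonoidHom (fun _ : τ ↦ ℤ_[p]) t).comp (e.toAddMonoidHom.comp
      ({ toFun := fun a ↦ ⟨H.index • a, H.nsmul_index_mem a⟩,
         map_zero' := Subtype.ext (by simp),
         map_add' := fun a b ↦ Subtype.ext (by simp) } : A →+ H))) (h : A) =
      (H.index : ℤ_[p]) * (if t = s then 1 else 0) := by
    intro t
    have hmem : (⟨H.index • (h : A), H.nsmul_index_mem (h : A)⟩ : H) = H.index • h :=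
      Subtype.ext (by simp)
    change e (⟨H.index • (h : A), H.nsmul_index_mem (h : A)⟩ : H) t = _
    rw [hmem, map_nsmul, hh, AddEquiv.apply_symm_apply, Pi.smul_apply, Pi.single_apply, nsmul_eq_mul]
  simp only [AddMonoidHom.smul_apply, hval, smul_eq_mul, mul_ite, mul_one, mul_zero,
    Finset.sum_ite_eq', Finset.mem_univ, if_true] at hev
  exact (mul_eq_zero.mp hev).resolve_right hidx

/-- **A `ℤ_p`-linear injection `Hom(A, ℤ_p) ↪ ℤ_p^σ` with `p`-saturated image is surjective when `A ⊇ ℤ_p^τ` with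
finite index and `#σ ≤ #τ`.** Rank count over the PID `ℤ_p`: `Hom(A, ℤ_p)` is finitely generated (it embeds in
`ℤ_p^σ`) of rank `≥ #τ` (`linearIndependent_dualLattice`), so the image `V` has rank `#σ`; the quotient
`ℤ_p^σ/V` has rank `0` (rank–nullity) and is torsion-free (`V` saturated, `mem_of_smul_mem_of_saturated`), hence
vanishes. In the application (Sprung 2012 Thm. 2.2 / Cor. 2.10 dual form + Silverman VII.6.3) it says: the
orbit-evaluation of functionals on `E(k_n)` is ONTO its coordinate lattice. [folklore]
[cite: Sprung2012, Lemma 2.3 and Cor. 2.10 (pp. 1487–1489)] -/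
theorem surjective_of_injective_of_saturated {A : Type*} [AddCommGroup A] {σ τ : Type*} [Fintype σ]
    [Fintype τ] (H : AddSubgroup A) [H.FiniteIndex] (e : H ≃+ (τ → ℤ_[p]))
    (hcard : Fintype.card σ ≤ Fintype.card τ)
    (Φ : (A →+ ℤ_[p]) →ₗ[ℤ_[p]] (σ → ℤ_[p])) (hinj : Function.Injective Φ)
    (hsat : ∀ w : σ → ℤ_[p], (p : ℤ_[p]) • w ∈ LinearMap.range Φ → w ∈ LinearMap.range Φ) :
    Function.Surjective Φ := by
  haveI : Module.Finite ℤ_[p] (A →+ ℤ_[p]) := Module.Finite.of_injective Φ hinj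
  -- rank of `Hom(A, ℤ_p)` is at least `#τ`
  have h1 : Fintype.card τ ≤ Module.finrank ℤ_[p] (A →+ ℤ_[p]) :=
    (linearIndependent_dualLattice H e).fintype_card_le_finrank
  -- the image has the same rank, at most `#σ`
  set V : Submodule ℤ_[p] (σ → ℤ_[p]) := LinearMap.range Φ with hV
  have h2 : Module.finrank ℤ_[p] V = Module.finrank ℤ_[p] (A →+ ℤ_[p]) :=
    (LinearEquiv.ofInjective Φ hinj).finrank_eq.symm
  have h3 : Module.finrank ℤ_[p] V ≤ Fintype.card σ :=
    (Submodule.finrank_le V).trans_eq (Module.finrank_fintype_fun_eq_card ℤ_[p])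
  have hVrank : Module.finrank ℤ_[p] V = Fintype.card σ := le_antisymm h3 (by omega)
  -- the quotient has rank `0`
  have hQ : Module.finrank ℤ_[p] ((σ → ℤ_[p]) ⧸ V) = 0 := by
    have h := Submodule.finrank_quotient_add_finrank V
    rw [Module.finrank_fintype_fun_eq_card, hVrank] at h
    omega
  rw [Module.finrank_eq_zero_iff] at hQ
  -- and is torsion-free, hence `V = ⊤`
  have htop : V = ⊤ := by
    refine eq_top_iff.mpr fun w _ ↦ ?_
    obtain ⟨a, ha, haw⟩ := hQ (Submodule.Quotient.mk w)
    rw [← Submodule.Quotient.mk_smul, Submodule.Quotient.mk_eq_zero] at haw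
    exact mem_of_smul_mem_of_saturated V hsat ha haw
  exact LinearMap.range_eq_top.mp (hV ▸ htop)

end Literature.Algebra.Module

end
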